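import Summits.QuantumFields.BalabanUV.Beta.SymAveragingWardRootedStencils
import Summits.QuantumFields.BalabanUV.Beta.GAN24.BorderGaugeLegContact

/-!
# `GAN24.SymBorderGaugeLegContact` — the FLUCTUATION-slot pure-gauge law of an1's (0.4)-SYMMETRISED border table `symVhSAt ρ` (the type of the
# record field `SymTables.V` of the literal `JsB12Sym0`), kernel level (K-V1)sym, PACKED and PAIRED: the contact partner is the (0.4) packed first-order
# kernel of record `DshAn1.linSym04At ρ L`, weights `ψ(u + e_{κ′}) − ψ(z + ρ + L·e_μ)` — NO Maxwell operator

HONEST FRAMING (cell charter, verbatim): «discharging `BetaPertH` makes Bałaban's UV stability UNCONDITIONAL — a real constructive-QFT result;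
it is NOT the continuum limit and NOT the Clay problem.»  DERIVED cell leaf (pub-balaban, G-an2-4 formalisation swarm → CRUX TEAM (2), seat
`b2b-balaban-gan24-formalise-leaf-02`, gen 47), the (0.4)-twin of `GAN24.BorderGaugeLegContact` asked by the row owner ([GAN24P1-G19-W1] (W3): «the sym-table
twins … YES … the letters are asked AT the sym family, so the sym identities are the ones the END will cite»).  [folklore] kinematics: an1-g42's FUNCTIONAL
Ward identity `SymAveragingWardRooted.symSkewVHAt_grad_left` read at indicator forms (node 8's four-line script) and through node 7a's packer — nothing of
an1's is restated, no estimate, no limit, nothing cited, no `[cite:]` tag, no `def`, no `def … : Prop`; it instantiates NO binder of the β-function wall and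
discharges NO letter of (CONV-C) or of row D1's END.  NEVER «G-an2-4 closed»; NOT hS0, NOT D1, NOT `BetaPertH`, NOT continuum, NOT Clay.  «not in print;
our bookkeeping».
HONEST DEPENDENCY (cell records, verbatim): «continuum YM on T⁴ ⇐ BetaPertH ∧ nine spine estimates (0/9 proved); BetaPertH ⇐ (D1) ∧ (D4) ∧ CAP+tail;
G-an2-4 gates asym, D1 and NE2/3/4.»
ABSOLUTE RULE (cell charter, verbatim): «No internally-minted statement may enter as a cited fact. Every hypothesis is either kernel-proved in this
package or a verbatim quotation of a PUBLISHED theorem with page reference. The manuscript(s) under audit are NOT citable for their own disputed steps —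
they are the thing under adjudication; programme-internal (2001/route/tribunal) claims are never citable.»

THE OBJECTS (generic `d`, fine lattice `ℤ^(d+1)`, blocking `L ≥ 1`, root offset `ρ`, `e_κ := AffineAveraging.unitVec κ`).  an1's (0.4)-SYMMETRISED
(`d!`-fold path-ordering mean, [Balaban1987RG1] (0.4) as a LOCATOR only) counts `symLinCountAt`∕`symVhCountAt` and real kernels
`q¹,ρ_sym = symLinKerAt = LIN∕(d!·L^d)`, `m^ρ_sym = symVhKerAt = VH∕(2(d!)²L^{2d})` (`SymAveragingHessianCounts`), the packed table
`V := symVhSAt ρ d L = packVH m^ρ_sym` (slots as in the comb table: background bond `(κ′, u)` = family index, fluctuation leg `(α, x)` on `inl`, multiplier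
leg of the coarse bond `(μ, z/L)` on `inr`), and the (0.4) packed first-order kernel OF RECORD `DshAn1.linSym04At ρ L` (entries `lin04KerAt = symLinKerAt`,
`SymAveragingWardRootedStencils.lin04KerAt_eq_symLinKerAt`).  The INDEX-leg law of `V` is an1-g42's (S-V)⁰⁴ `divV_symVhSAt_eq_conjV` (TREE; from
(K-V2)sym `symVhKerAt_div_right`).  THIS FILE is the OTHER field leg.
## What is proved ([folklore]; `r := L·y + ρ` the root of the coarse bond `(μ, y)`, `r + L·e_μ` its far endpoint)
* §1 KERNEL LEVEL (the (0.4)-twins of node 8ρ's `AveragingWardRootedKernels.vhCountAt_div_left` ∕ `vhKerAt_div_left`, NOT previously in the tree):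
  **`symVhCountAt_div_left`** `Σ_κ (VH_sym((κ, z − e_κ), f′) − VH_sym((κ, z), f′)) = 2·d!·L^d · ([f′₊ = z] − [r + L·e_μ = z]) · LIN_sym(f′)` and the real form
  **`symVhKerAt_div_left`** `… = ([f′₊ = z] − [r + L·e_μ = z]) · q¹,ρ_sym(f′)` (same shape and normalisation as the comb law).
* §2 PACKED: **`gaugeLeg_symVhSAt_inl_inr`** `Σ_α (V κ′ u (x − e_α) z (inl α) (inr μ) − V κ′ u x z (inl α) (inr μ)) = ([u + e_{κ′} = x] − [z + ρ + L·e_μ = x]) ·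
  linSym04At ρ L u z (inl κ′) (inr μ)`, twin **`gaugeLeg_symVhSAt_inr_inl`**, vanishing off the two contact sites.
* §3 PAIRED with ANY `ψ` (every root): **`gaugeLeg_symVhSAt_tsum`** `Σ'_x ψ x · (…) = (ψ(u + e_{κ′}) − ψ(z + ρ + L·e_μ)) · linSym04At ρ L u z (inl κ′) (inr μ)`, `_right`;
  the `dψ`-forms for a box root **`tsum_dz_mul_symVhSAt`** ∕ **`tsum_symVhSAt_mul_dz`** (finite support `symVhKerAt_eq_zero_left`; the generic by-parts lemma
  `BorderGaugeLegContact.tsum_sum_dz_mul_eq`).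
NOT HERE: the symmetrised Hessian `symHessFFAt` and its Λ-piece (sequel `GAN24.SymHessianGaugeLegContact`); any contact CELL or power count (owner's
X-gan24p1-g19-2 ∕ CT-3m).
Provenance: seat b2b-balaban-gan24-formalise-leaf-02 gen 47 (prover-…-leaf-02-g47-0), 2026-08-21; over an1's gen 41∕42 sym files named above BY NAME.
-/

open Finset
open scoped BigOperators Nat
open Literature.MathematicalPhysics.QuantumFieldTheory.Balaban1983to89
open Literature.MathematicalPhysics.QuantumFieldTheory.Balaban1983to89.Beta
open AffineAveraging AveragingContours TransportedContourVariables AveragingHessianKernels AveragingWardJets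
  AveragingContoursRooted AveragingHessianKernelsRooted
open ExpKernelCalculus (MKer)
open OneStepResolventKernel (Fib)
open Summit.QuantumFields.BalabanUV.Beta.SymAveragingHessianCounts
open Summit.QuantumFields.BalabanUV.Beta.SymAveragingWardRooted
open Summit.QuantumFields.BalabanUV.Beta.SymAveragingWardRootedStencils (lin04KerAt_eq_symLinKerAt)
open Summit.QuantumFields.BalabanUV.Beta.DshAn1 (linSym04At linSym04At_inl_inr linSym04At_inr_inl)
open Summit.QuantumFields.BalabanUV.Beta.LinearGaugeVH (nearBox mem_nearBox summable_of_finsupp)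
open Summit.QuantumFields.BalabanUV.Beta.GAN24.BorderGaugeLegContact (tsum_mul_ite_sub_ite_mul tsum_sum_dz_mul_eq)

noncomputable section

namespace Summit.QuantumFields.BalabanUV.Beta.GAN24.SymBorderGaugeLegContact

variable {d : ℕ}

/-! ## §1 (K-V1)sym — kernel level -/

section Kernel

/-- [folklore] **(K-V1)sym BACKWARD-DIVERGENCE LAW OF THE SYMMETRISED PRODUCT-CHART COUNT in its FLUCTUATION bond**:
`Σ_κ (symVhCountAt ρ (κ, z − e_κ) f′ − symVhCountAt ρ (κ, z) f′) = 2·d!·L^d · ([f′₊ = z] − [r + L·e_μ = z]) · symLinCountAt ρ f′` — an1-g42's functional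
identity `symSkewVHAt_grad_left` at indicator forms (node 8's script; the (0.4)-twin of node 8ρ's `vhCountAt_div_left`). -/
theorem symVhCountAt_div_left (ρ : Fin d → ℤ) (L : ℕ) (μ : Fin d) (y : Fin d → ℤ) (z : Fin d → ℤ) (f' : Bond d) :
    ∑ κ : Fin d, (symVhCountAt ρ L μ y (κ, z - unitVec κ) f' - symVhCountAt ρ L μ y (κ, z) f')
      = 2 * (d ! : ℤ) * (L : ℤ) ^ d
        * (((if f'.2 + unitVec f'.1 = z then 1 else 0) - (if (L : ℤ) • y + ρ + (L : ℤ) • unitVec μ = z then 1 else 0))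
          * symLinCountAt ρ L μ y f') := by
  simp only [symVhCountAt_eq_symSkewVHAt, ← symSkewVHAt_sub_left, ← symSkewVHAt_sum_left, ← grad_siteδ, symSkewVHAt_grad_left,
    endF_mulZ_siteδ, symZ_single, symZ_δ1, siteδ_apply, AddMonoidHom.mul_apply, smul_eq_mul]
  ring

/-- [folklore] **(K-V1)sym for the REAL symmetrised kernel** `m^ρ_sym = VH∕(2(d!)²L^{2d})`: divergence in the fluctuation bond
`= ([f′₊ = z] − [r + L·e_μ = z]) · q¹,ρ_sym(f′)` (`q¹,ρ_sym = LIN∕(d!·L^d)`; the same shape as the comb law `vhKerAt_div_left`). -/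
theorem symVhKerAt_div_left {L : ℕ} (hL : 1 ≤ L) (ρ : Fin d → ℤ) (μ : Fin d) (y : Fin d → ℤ) (z : Fin d → ℤ) (f' : Bond d) :
    ∑ κ : Fin d, (symVhKerAt ρ L μ y (κ, z - unitVec κ) f' - symVhKerAt ρ L μ y (κ, z) f')
      = ((if f'.2 + unitVec f'.1 = z then 1 else 0) - (if (L : ℤ) • y + ρ + (L : ℤ) • unitVec μ = z then 1 else 0))
        * symLinKerAt ρ L μ y f' := by
  have hL' : (L : ℝ) ≠ 0 := by exact_mod_cast (show L ≠ 0 by omega)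
  have hd : (d ! : ℝ) ≠ 0 := by exact_mod_cast (Nat.factorial_ne_zero d)
  simp only [symVhKerAt, symLinKerAt, ← sub_div, ← Finset.sum_div, ← Int.cast_sub, ← Int.cast_sum, symVhCountAt_div_left]
  push_cast
  field_simp
  ring

end Kernel

/-! ## §2 The packed symmetrised border table: entrywise fluctuation-slot law -/

section Entry

/-- [folklore] **THE FLUCTUATION-SLOT PURE-GAUGE LAW OF THE SYMMETRISED BORDER TABLE, `(inl α, inr μ)` BLOCK**:
`Σ_α (symVhSAt ρ κ′ u (x − e_α) z (inl α) (inr μ) − symVhSAt ρ κ′ u x z (inl α) (inr μ)) = ([u + e_{κ′} = x] − [z + ρ + L·e_μ = x]) · linSym04At ρ L u z (inl κ′) (inr μ)`. -/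
theorem gaugeLeg_symVhSAt_inl_inr {L : ℕ} (hL : 1 ≤ L) (ρ : Fin (d + 1) → ℤ) (κ' : Fin (d + 1)) (u x z : Fin (d + 1) → ℤ) (μ : Fin (d + 1)) :
    (∑ α, (symVhSAt ρ d L rfl κ' u (x - unitVec α) z (Sum.inl α) (Sum.inr μ) - symVhSAt ρ d L rfl κ' u x z (Sum.inl α) (Sum.inr μ)))
      = ((if u + unitVec κ' = x then 1 else 0) - (if z + ρ + (L : ℤ) • unitVec μ = x then 1 else 0))
        * linSym04At ρ L u z (Sum.inl κ') (Sum.inr μ) := by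
  simp only [symVhSAt, packVH_inl_inr, linSym04At_inl_inr, lin04KerAt_eq_symLinKerAt]
  by_cases hz : off L z = 0
  · simp only [hz, if_true]
    rw [symVhKerAt_div_left hL, ← eq_smul_blk_of_off_eq_zero hL hz]
  · simp [hz]

/-- [folklore] **THE `(inr μ, inl α)` BLOCK** (fluctuation leg in the second slot):
`Σ_α (symVhSAt ρ κ′ u x (z − e_α) (inr μ) (inl α) − symVhSAt ρ κ′ u x z (inr μ) (inl α)) = ([u + e_{κ′} = z] − [x + ρ + L·e_μ = z]) · linSym04At ρ L x u (inr μ) (inl κ′)`. -/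
theorem gaugeLeg_symVhSAt_inr_inl {L : ℕ} (hL : 1 ≤ L) (ρ : Fin (d + 1) → ℤ) (κ' : Fin (d + 1)) (u x z : Fin (d + 1) → ℤ) (μ : Fin (d + 1)) :
    (∑ α, (symVhSAt ρ d L rfl κ' u x (z - unitVec α) (Sum.inr μ) (Sum.inl α) - symVhSAt ρ d L rfl κ' u x z (Sum.inr μ) (Sum.inl α)))
      = ((if u + unitVec κ' = z then 1 else 0) - (if x + ρ + (L : ℤ) • unitVec μ = z then 1 else 0))
        * linSym04At ρ L x u (Sum.inr μ) (Sum.inl κ') := by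
  simp only [symVhSAt, packVH_inr_inl, linSym04At_inr_inl, lin04KerAt_eq_symLinKerAt]
  by_cases hx : off L x = 0
  · simp only [hx, if_true]
    rw [symVhKerAt_div_left hL, ← eq_smul_blk_of_off_eq_zero hL hx]
  · simp [hx]

/-- [folklore] The fluctuation-slot variation vanishes on the field–field block. -/
theorem gaugeLeg_symVhSAt_inl_inl (ρ : Fin (d + 1) → ℤ) (L : ℕ) (κ' : Fin (d + 1)) (u x z : Fin (d + 1) → ℤ) (α' : Fin (d + 1)) :
    (∑ α, (symVhSAt ρ d L rfl κ' u (x - unitVec α) z (Sum.inl α) (Sum.inl α') - symVhSAt ρ d L rfl κ' u x z (Sum.inl α) (Sum.inl α'))) = 0 := by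
  simp [symVhSAt]

/-- [folklore] Off the two contact sites the `(inl, inr)` variation vanishes. -/
theorem gaugeLeg_symVhSAt_inl_inr_eq_zero {L : ℕ} (hL : 1 ≤ L) {ρ : Fin (d + 1) → ℤ} {κ' : Fin (d + 1)} {u x z : Fin (d + 1) → ℤ}
    {μ : Fin (d + 1)} (hu : u + unitVec κ' ≠ x) (hz : z + ρ + (L : ℤ) • unitVec μ ≠ x) :
    (∑ α, (symVhSAt ρ d L rfl κ' u (x - unitVec α) z (Sum.inl α) (Sum.inr μ) - symVhSAt ρ d L rfl κ' u x z (Sum.inl α) (Sum.inr μ))) = 0 := by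
  rw [gaugeLeg_symVhSAt_inl_inr hL, if_neg hu, if_neg hz, sub_zero, zero_mul]

/-- [folklore] Off the two contact sites the `(inr, inl)` variation vanishes. -/
theorem gaugeLeg_symVhSAt_inr_inl_eq_zero {L : ℕ} (hL : 1 ≤ L) {ρ : Fin (d + 1) → ℤ} {κ' : Fin (d + 1)} {u x z : Fin (d + 1) → ℤ}
    {μ : Fin (d + 1)} (hu : u + unitVec κ' ≠ z) (hx : x + ρ + (L : ℤ) • unitVec μ ≠ z) :
    (∑ α, (symVhSAt ρ d L rfl κ' u x (z - unitVec α) (Sum.inr μ) (Sum.inl α) - symVhSAt ρ d L rfl κ' u x z (Sum.inr μ) (Sum.inl α))) = 0 := by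
  rw [gaugeLeg_symVhSAt_inr_inl hL, if_neg hu, if_neg hx, sub_zero, zero_mul]

end Entry

/-! ## §3 Paired with any gauge function; the `dψ`-forms -/

section Paired

/-- [folklore] **PAIRED WITH ANY GAUGE FUNCTION**, `(inl, inr)` block (every root):
`Σ'_x ψ x · Σ_α (…) = (ψ(u + e_{κ′}) − ψ(z + ρ + L·e_μ)) · linSym04At ρ L u z (inl κ′) (inr μ)`. -/
theorem gaugeLeg_symVhSAt_tsum {L : ℕ} (hL : 1 ≤ L) (ρ : Fin (d + 1) → ℤ) (κ' : Fin (d + 1)) (u z : Fin (d + 1) → ℤ) (μ : Fin (d + 1))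
    (ψ : (Fin (d + 1) → ℤ) → ℝ) :
    ∑' x, ψ x * ∑ α, (symVhSAt ρ d L rfl κ' u (x - unitVec α) z (Sum.inl α) (Sum.inr μ) - symVhSAt ρ d L rfl κ' u x z (Sum.inl α) (Sum.inr μ))
      = (ψ (u + unitVec κ') - ψ (z + ρ + (L : ℤ) • unitVec μ)) * linSym04At ρ L u z (Sum.inl κ') (Sum.inr μ) := by
  simp only [gaugeLeg_symVhSAt_inl_inr hL]
  exact tsum_mul_ite_sub_ite_mul ψ _ _ _

/-- [folklore] **… `(inr, inl)` block**: `Σ'_z ψ z · Σ_α (…) = (ψ(u + e_{κ′}) − ψ(x + ρ + L·e_μ)) · linSym04At ρ L x u (inr μ) (inl κ′)`. -/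
theorem gaugeLeg_symVhSAt_tsum_right {L : ℕ} (hL : 1 ≤ L) (ρ : Fin (d + 1) → ℤ) (κ' : Fin (d + 1)) (u x : Fin (d + 1) → ℤ) (μ : Fin (d + 1))
    (ψ : (Fin (d + 1) → ℤ) → ℝ) :
    ∑' z, ψ z * ∑ α, (symVhSAt ρ d L rfl κ' u x (z - unitVec α) (Sum.inr μ) (Sum.inl α) - symVhSAt ρ d L rfl κ' u x z (Sum.inr μ) (Sum.inl α))
      = (ψ (u + unitVec κ') - ψ (x + ρ + (L : ℤ) • unitVec μ)) * linSym04At ρ L x u (Sum.inr μ) (Sum.inl κ') := by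
  simp only [gaugeLeg_symVhSAt_inr_inl hL]
  exact tsum_mul_ite_sub_ite_mul ψ _ _ _

/-- [folklore] For a box root the `(inl, inr)` entry vanishes unless the fluctuation site lies in the support box of the multiplier leg's block
(`symVhKerAt_eq_zero_left` through the packer). -/
theorem symVhSAt_inl_inr_eq_zero_of_not_mem {L : ℕ} {r : Fin (d + 1) → ℕ} (hr : r ∈ box (d + 1) L) (κ' : Fin (d + 1)) (u z : Fin (d + 1) → ℤ)
    (α μ : Fin (d + 1)) {x : Fin (d + 1) → ℤ} (hx : x ∉ nearBox L (blk L z)) :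
    symVhSAt (toSite r) d L rfl κ' u x z (Sum.inl α) (Sum.inr μ) = 0 := by
  rw [mem_nearBox] at hx
  simp only [symVhSAt, packVH_inl_inr]
  split_ifs
  · exact symVhKerAt_eq_zero_left hr (f := (α, x)) hx _
  · rfl

/-- [folklore] The same for the `(inr, inl)` entry. -/
theorem symVhSAt_inr_inl_eq_zero_of_not_mem {L : ℕ} {r : Fin (d + 1) → ℕ} (hr : r ∈ box (d + 1) L) (κ' : Fin (d + 1)) (u x : Fin (d + 1) → ℤ)
    (μ α : Fin (d + 1)) {z : Fin (d + 1) → ℤ} (hz : z ∉ nearBox L (blk L x)) :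
    symVhSAt (toSite r) d L rfl κ' u x z (Sum.inr μ) (Sum.inl α) = 0 := by
  rw [mem_nearBox] at hz
  simp only [symVhSAt, packVH_inr_inl]
  split_ifs
  · exact symVhKerAt_eq_zero_left hr (f := (α, z)) hz _
  · rfl

/-- [folklore] Any function times the `(inl, inr)` entry is summable over the fluctuation site (finite support). -/
theorem summable_mul_symVhSAt {L : ℕ} {r : Fin (d + 1) → ℕ} (hr : r ∈ box (d + 1) L) (κ' : Fin (d + 1)) (u z : Fin (d + 1) → ℤ)
    (α μ : Fin (d + 1)) (g : (Fin (d + 1) → ℤ) → ℝ) :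
    Summable fun x => g x * symVhSAt (toSite r) d L rfl κ' u x z (Sum.inl α) (Sum.inr μ) :=
  summable_of_finsupp (nearBox L (blk L z)) fun x hx => by rw [symVhSAt_inl_inr_eq_zero_of_not_mem hr κ' u z α μ hx, mul_zero]

/-- [folklore] Any function times the `(inr, inl)` entry is summable over the second-slot site (finite support). -/
theorem summable_mul_symVhSAt_right {L : ℕ} {r : Fin (d + 1) → ℕ} (hr : r ∈ box (d + 1) L) (κ' : Fin (d + 1)) (u x : Fin (d + 1) → ℤ)
    (μ α : Fin (d + 1)) (g : (Fin (d + 1) → ℤ) → ℝ) :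
    Summable fun z => g z * symVhSAt (toSite r) d L rfl κ' u x z (Sum.inr μ) (Sum.inl α) :=
  summable_of_finsupp (nearBox L (blk L x)) fun z hz => by rw [symVhSAt_inr_inl_eq_zero_of_not_mem hr κ' u x μ α hz, mul_zero]

/-- [folklore] **THE `dψ`-FORM OF THE FLUCTUATION-SLOT LAW** (box root `ρ = toSite r`, `r ∈ box`):
`Σ'_x Σ_α (dz ψ) α x · symVhSAt ρ κ′ u x z (inl α) (inr μ) = (ψ(u + e_{κ′}) − ψ(z + ρ + L·e_μ)) · linSym04At ρ L u z (inl κ′) (inr μ)`, for EVERY `ψ`. -/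
theorem tsum_dz_mul_symVhSAt {L : ℕ} (hL : 1 ≤ L) {r : Fin (d + 1) → ℕ} (hr : r ∈ box (d + 1) L) (κ' : Fin (d + 1)) (u z : Fin (d + 1) → ℤ)
    (μ : Fin (d + 1)) (ψ : (Fin (d + 1) → ℤ) → ℝ) :
    ∑' x, ∑ α, dz ψ α x * symVhSAt (toSite r) d L rfl κ' u x z (Sum.inl α) (Sum.inr μ)
      = (ψ (u + unitVec κ') - ψ (z + toSite r + (L : ℤ) • unitVec μ)) * linSym04At (toSite r) L u z (Sum.inl κ') (Sum.inr μ) := by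
  rw [tsum_sum_dz_mul_eq (fun α x => symVhSAt (toSite r) d L rfl κ' u x z (Sum.inl α) (Sum.inr μ))
    (fun α g => summable_mul_symVhSAt hr κ' u z α μ g) ψ]
  exact gaugeLeg_symVhSAt_tsum hL (toSite r) κ' u z μ ψ

/-- [folklore] **THE `dψ`-FORM, SECOND SLOT**: `Σ'_z Σ_α symVhSAt ρ κ′ u x z (inr μ) (inl α) · (dz ψ) α z = (ψ(u + e_{κ′}) − ψ(x + ρ + L·e_μ)) · linSym04At ρ L x u (inr μ) (inl κ′)`. -/
theorem tsum_symVhSAt_mul_dz {L : ℕ} (hL : 1 ≤ L) {r : Fin (d + 1) → ℕ} (hr : r ∈ box (d + 1) L) (κ' : Fin (d + 1)) (u x : Fin (d + 1) → ℤ)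
    (μ : Fin (d + 1)) (ψ : (Fin (d + 1) → ℤ) → ℝ) :
    ∑' z, ∑ α, symVhSAt (toSite r) d L rfl κ' u x z (Sum.inr μ) (Sum.inl α) * dz ψ α z
      = (ψ (u + unitVec κ') - ψ (x + toSite r + (L : ℤ) • unitVec μ)) * linSym04At (toSite r) L x u (Sum.inr μ) (Sum.inl κ') := by
  have h : ∀ z, ∑ α, symVhSAt (toSite r) d L rfl κ' u x z (Sum.inr μ) (Sum.inl α) * dz ψ α z
      = ∑ α, dz ψ α z * symVhSAt (toSite r) d L rfl κ' u x z (Sum.inr μ) (Sum.inl α) := fun z => Finset.sum_congr rfl fun α _ => mul_comm _ _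
  rw [tsum_congr h, tsum_sum_dz_mul_eq (fun α z => symVhSAt (toSite r) d L rfl κ' u x z (Sum.inr μ) (Sum.inl α))
    (fun α g => summable_mul_symVhSAt_right hr κ' u x μ α g) ψ]
  exact gaugeLeg_symVhSAt_tsum_right hL (toSite r) κ' u x μ ψ

end Paired

end Summit.QuantumFields.BalabanUV.Beta.GAN24.SymBorderGaugeLegContact

end
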